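import Mathlib
import HarnessLib
import Summits.HubbardSuperconductivity.HubbardSuperconductivity.Theorems.WeakCouplingBCSKlAllOrdersSelectionWindow

/-!
# Route `WeakCouplingBCS` — channel-margin lane of `WcbcsKohnLuttingerB1g` (stmt-HubbardSuperconductivity-0158):
# BOX-WISE thresholds `U₀(μ)` on the window — third order, resummed chains, all orders modulo `C4`

The window theorems (`klThirdOrder_selection_window`, `klResummed_selection_window`, `klAllOrders_selection_window`) state `B1g`
selection for the window-UNIFORM threshold `u = klU0WindowU = 1145/2²⁴ ≈ 6.8·10⁻⁵`, the minimum over the 44 boxes of the box-wise `U0`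
(attained at box `klU0w33`, `μ ≈ -0.23`).  Each window row `w ∈ klU0WindowRows` (`Theorems/WeakCouplingBCSDefsKlU0WindowRecord.lean`,
cell file U0-TABLE.md v3) carries its own kernel-checked `w.row.U0` (from `6.8·10⁻⁵` up to `4.0·10⁻⁴`), so the same chain gives the
**box-wise** statements: for every `μ` in the box of `w`, selection holds for `0 < U ≤ w.row.U0` —

* `klbw_rows_ok` (kernel decision: every window row passes `KLU0Row.ok`);
* `klThirdOrder_selection_boxwise`, `klResummed_selection_boxwise`, `klAllOrders_selection_boxwise` (remainder bound `C4 = 10` per `U⁴` on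
  `(0, 1/16]`, the rows' constants, `klaow_row_consts`);
* the thin-margin end of the doping window as an instance: on `μ ∈ [-0.42749, -0.4225]` (box `klU0w00`, `∋ μ(δ = 0.20) ≈ -0.4267`, smallest
  second-order margin of the box `0.0288`) selection through third order / with resummed chains / to all orders modulo `C4 = 10` holds for
  `0 < U ≤ 4267/2²⁴ ≈ 2.54·10⁻⁴` (`…_box00`) — 3.7× the window-uniform `u`.

All modulo the named hypotheses of the window files (`klCertB1gWin{A,B,C}.EnclosuresB1g`, `KlThirdOrderWindowEnclosures` /
`KlResummedWindowEnclosures`); existence-grade thresholds; `C4` ASSUMED; nothing here asserts a pairing instability.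
-/

noncomputable section

-- the tree's namespace `Summit.<Summit>.<Problem>.Theorems` repeats the summit name by design (D-0017)
set_option linter.dupNamespace false

namespace Summit.HubbardSuperconductivity.HubbardSuperconductivity.Theorems

open MeasureTheory Real Literature.MathematicalPhysics.QuantumLattice CwKLChiralWindow KlThirdOrder

/-- Kernel decision: every window row passes the row check `KLU0Row.ok` (part of `klU0WindowRows_check`, restated row-wise). [folklore] -/
theorem klbw_rows_ok : (klU0WindowRows.all fun w => w.row.ok) = true := by
  decide +kernel

/-- The box data of a window row: a record `c ∈ [WinA, WinB, WinC]`, a box `bx` of `c` containing the row's box, consistent with the row,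
passing `basicOKB1gD`, with `μ ∈ (-4, 0)` and the second-order enclosures at every `μ` of the row's box. [folklore] -/
theorem klbw_box_data (hA : klCertB1gWinA.EnclosuresB1g) (hB : klCertB1gWinB.EnclosuresB1g) (hC : klCertB1gWinC.EnclosuresB1g)
    (w : KLU0WinRow) (hw : w ∈ klU0WindowRows) (μ : ℝ) (hlo : ((w.mulo : ℚ) : ℝ) ≤ μ) (hhi : μ ≤ ((w.muhi : ℚ) : ℝ)) :
    ∃ c ∈ [klCertB1gWinA, klCertB1gWinB, klCertB1gWinC], ∃ bx ∈ c.boxes,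
      bx.mulo ≤ w.mulo ∧ w.muhi ≤ bx.muhi ∧ w.row.dominates bx c.trials = true ∧ bx.basicOKB1gD c.trials = true ∧
      μ ∈ Set.Ioo (-4 : ℝ) 0 ∧ bx.bB1g.RitzEnclosure c.trials μ ∧
      (∀ χ : D4Irrep, χ ≠ D4Irrep.B1g → (bx.blk χ).Enclosure c.trials μ χ) ∧ w.row.ok = true := by
  obtain ⟨c, hc, bx, hbx, hcl, hch, hdom⟩ := klThirdOrderWindowJoin_spec _ _ klto_window_join w hw
  obtain ⟨hcheckc, hEc⟩ := klto_window_recs hA hB hC c hc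
  obtain ⟨-, hboxes, -⟩ := klb1gd_coverLogic c hcheckc
  obtain ⟨hBx, -⟩ := hboxes bx hbx
  have hB' := hBx
  simp only [KLBox.basicOKB1gD, Bool.and_eq_true, decide_eq_true_eq] at hB'
  obtain ⟨⟨⟨⟨⟨⟨⟨h4, -⟩, h0⟩, -⟩, -⟩, -⟩, -⟩, -⟩ := hB'
  have hlo' : ((bx.mulo : ℚ) : ℝ) ≤ μ := le_trans (by exact_mod_cast hcl) hlo
  have hhi' : μ ≤ ((bx.muhi : ℚ) : ℝ) := le_trans hhi (by exact_mod_cast hch)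
  have hμ : μ ∈ Set.Ioo (-4 : ℝ) 0 :=
    ⟨lt_of_lt_of_le (by exact_mod_cast h4) hlo', lt_of_le_of_lt hhi' (by exact_mod_cast h0)⟩
  obtain ⟨hER, hEχ⟩ := hEc bx hbx μ ⟨hlo', hhi'⟩
  have hok : w.row.ok = true := List.all_eq_true.1 klbw_rows_ok w hw
  exact ⟨c, hc, bx, hbx, hcl, hch, hdom, hBx, hμ, hER, hEχ, hok⟩

/-- **Box-wise third-order selection**: for every window row `w`, every `μ` in its box and every `0 < U ≤ w.row.U0`, the normalised `B1g`
trial lies strictly below every normalised `A1g/A2g/B2g/E` state in `thirdOrderForm ε₀ μ U`, modulo `klCertB1gWin{A,B,C}.EnclosuresB1g` and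
`KlThirdOrderWindowEnclosures`. [cite: RaghuKivelsonScalapino2010, App. A] -/
theorem klThirdOrder_selection_boxwise (hA : klCertB1gWinA.EnclosuresB1g) (hB : klCertB1gWinB.EnclosuresB1g)
    (hC : klCertB1gWinC.EnclosuresB1g)
    (h3 : KlThirdOrderWindowEnclosures klU0WindowRows [klCertB1gWinA, klCertB1gWinB, klCertB1gWinC]) :
    ∀ w ∈ klU0WindowRows, ∀ μ : ℝ, ((w.mulo : ℚ) : ℝ) ≤ μ → μ ≤ ((w.muhi : ℚ) : ℝ) →
      ∃ ψ : Momentum → ℝ, IsChannelState (squareDispersion 1 0) μ D4Irrep.B1g ψ ∧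
        ∀ U : ℝ, 0 < U → U ≤ ((w.row.U0 : ℚ) : ℝ) → ∀ χ : D4Irrep, χ ≠ D4Irrep.B1g →
          ∀ φ : Momentum → ℝ, IsChannelState (squareDispersion 1 0) μ χ φ →
            thirdOrderForm (squareDispersion 1 0) μ U ψ < thirdOrderForm (squareDispersion 1 0) μ U φ := by
  intro w hw μ hlo hhi
  obtain ⟨c, hc, bx, hbx, hcl, hch, hdom, hBx, hμ, hER, hEχ, hok⟩ := klbw_box_data hA hB hC w hw μ hlo hhi
  have h3w := h3 w hw c hc bx hbx hcl hch hdom μ hlo hhi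
  exact klThirdOrder_selectionD hμ bx c.trials hBx hER hEχ w.row hok hdom h3w

/-- **Box-wise selection with the chains resummed.** [cite: ScalapinoLohHirsch1986, (3)-(4)] -/
theorem klResummed_selection_boxwise (hA : klCertB1gWinA.EnclosuresB1g) (hB : klCertB1gWinB.EnclosuresB1g)
    (hC : klCertB1gWinC.EnclosuresB1g)
    (h3 : KlResummedWindowEnclosures klU0WindowRows [klCertB1gWinA, klCertB1gWinB, klCertB1gWinC]) :
    ∀ w ∈ klU0WindowRows, ∀ μ : ℝ, ((w.mulo : ℚ) : ℝ) ≤ μ → μ ≤ ((w.muhi : ℚ) : ℝ) →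
      ∃ ψ : Momentum → ℝ, IsChannelState (squareDispersion 1 0) μ D4Irrep.B1g ψ ∧
        ∀ U : ℝ, 0 < U → U ≤ ((w.row.U0 : ℚ) : ℝ) → ∀ χ : D4Irrep, χ ≠ D4Irrep.B1g →
          ∀ φ : Momentum → ℝ, IsChannelState (squareDispersion 1 0) μ χ φ →
            resummedForm (squareDispersion 1 0) μ U ψ < resummedForm (squareDispersion 1 0) μ U φ := by
  intro w hw μ hlo hhi
  obtain ⟨c, hc, bx, hbx, hcl, hch, hdom, hBx, hμ, hER, hEχ, hok⟩ := klbw_box_data hA hB hC w hw μ hlo hhi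
  have h3w := h3 w hw c hc bx hbx hcl hch hdom μ hlo hhi
  exact klResummed_selectionD hμ bx c.trials hBx hER hEχ w.row hok hdom h3w

/-- **Box-wise selection to ALL orders modulo `C4 = 10`**: for every window row `w`, every `μ` in its box, every remainder kernel `R` whose form
is `≤ 10 ‖Φ_B‖²` on the `B1g` trial of each record box containing `w`'s box and `≥ -10` on normalised competitor states for `0 < U ≤ 1/16`, and
every `0 < U ≤ w.row.U0`: `B1g` strictly lowest in `resummedForm + U² ⟨·, R U ·⟩`.  `C4` ASSUMED. [cite: RaghuKivelsonScalapino2010, App. A] -/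
theorem klAllOrders_selection_boxwise (hA : klCertB1gWinA.EnclosuresB1g) (hB : klCertB1gWinB.EnclosuresB1g)
    (hC : klCertB1gWinC.EnclosuresB1g)
    (h3 : KlResummedWindowEnclosures klU0WindowRows [klCertB1gWinA, klCertB1gWinB, klCertB1gWinC])
    (R : ℝ → Momentum → Momentum → ℝ)
    (hRB : ∀ c ∈ [klCertB1gWinA, klCertB1gWinB, klCertB1gWinC], ∀ bx ∈ c.boxes, ∀ μ : ℝ,
      ((bx.mulo : ℚ) : ℝ) ≤ μ → μ ≤ ((bx.muhi : ℚ) : ℝ) → ∀ U : ℝ, 0 < U → U ≤ 1 / 16 →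
        kform (fermiCurveMeasure (squareDispersion 1 0) μ) (R U) (bx.bB1g.trialFun c.trials) ≤
          10 * ∫ k, bx.bB1g.trialFun c.trials k ^ 2 ∂fermiCurveMeasure (squareDispersion 1 0) μ)
    (hRχ : ∀ μ : ℝ, ∀ U : ℝ, 0 < U → U ≤ 1 / 16 → ∀ χ : D4Irrep, χ ≠ D4Irrep.B1g →
      ∀ φ : Momentum → ℝ, IsChannelState (squareDispersion 1 0) μ χ φ →
        -10 ≤ kform (fermiCurveMeasure (squareDispersion 1 0) μ) (R U) φ) :
    ∀ w ∈ klU0WindowRows, ∀ μ : ℝ, ((w.mulo : ℚ) : ℝ) ≤ μ → μ ≤ ((w.muhi : ℚ) : ℝ) →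
      ∃ ψ : Momentum → ℝ, IsChannelState (squareDispersion 1 0) μ D4Irrep.B1g ψ ∧
        ∀ U : ℝ, 0 < U → U ≤ ((w.row.U0 : ℚ) : ℝ) → ∀ χ : D4Irrep, χ ≠ D4Irrep.B1g →
          ∀ φ : Momentum → ℝ, IsChannelState (squareDispersion 1 0) μ χ φ →
            resummedForm (squareDispersion 1 0) μ U ψ + U ^ 2 * kform (fermiCurveMeasure (squareDispersion 1 0) μ) (R U) ψ <
              resummedForm (squareDispersion 1 0) μ U φ + U ^ 2 * kform (fermiCurveMeasure (squareDispersion 1 0) μ) (R U) φ := by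
  intro w hw μ hlo hhi
  obtain ⟨c, hc, bx, hbx, hcl, hch, hdom, hBx, hμ, hER, hEχ, hok⟩ := klbw_box_data hA hB hC w hw μ hlo hhi
  have h3w := h3 w hw c hc bx hbx hcl hch hdom μ hlo hhi
  have hlo' : ((bx.mulo : ℚ) : ℝ) ≤ μ := le_trans (by exact_mod_cast hcl) hlo
  have hhi' : μ ≤ ((bx.muhi : ℚ) : ℝ) := le_trans hhi (by exact_mod_cast hch)
  obtain ⟨hC4, hU1⟩ := klaow_row_consts w hw
  have hRBw : ∀ U : ℝ, 0 < U → U ≤ w.row.U1 →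
      kform (fermiCurveMeasure (squareDispersion 1 0) μ) (R U) (bx.bB1g.trialFun c.trials) ≤
        (w.row.C4 : ℝ) * ∫ k, bx.bB1g.trialFun c.trials k ^ 2 ∂fermiCurveMeasure (squareDispersion 1 0) μ := by
    intro U hU hUU
    rw [hC4]
    exact hRB c hc bx hbx μ hlo' hhi' U hU (by rw [hU1] at hUU; exact hUU)
  have hRχw : ∀ U : ℝ, 0 < U → U ≤ w.row.U1 → ∀ χ : D4Irrep, χ ≠ D4Irrep.B1g →
      ∀ φ : Momentum → ℝ, IsChannelState (squareDispersion 1 0) μ χ φ →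
        -(w.row.C4 : ℝ) ≤ kform (fermiCurveMeasure (squareDispersion 1 0) μ) (R U) φ := by
    intro U hU hUU χ hχ φ hφ
    rw [hC4]
    exact hRχ μ U hU (by rw [hU1] at hUU; exact hUU) χ hχ φ hφ
  exact klAllOrders_selectionD hμ bx c.trials hBx hER hEχ w.row hok hdom h3w R hRBw hRχw

/-! ### The thin-margin end of the doping window: box `klU0w00` = `[-0.42749, -0.4225]` ∋ `μ(δ = 0.20)` -/

/-- `klU0w00` is the first window row; its box is `[-42749/100000, -169/400]` and its threshold `U0 = 4267/2²⁴`. [folklore] -/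
theorem klbw_w00_data : klU0w00 ∈ klU0WindowRows ∧ klU0w00.mulo = (-42749 : ℚ) / 100000 ∧ klU0w00.muhi = (-169 : ℚ) / 400 ∧
    klU0w00.row.U0 = (4267 : ℚ) / 16777216 := by
  refine ⟨?_, rfl, rfl, rfl⟩
  unfold klU0WindowRows
  exact List.mem_cons_self

/-- **Third-order `B1g` selection at the `δ ≈ 0.20` end for `0 < U ≤ 4267/2²⁴ ≈ 2.54·10⁻⁴`**: for every `μ ∈ [-0.42749, -0.4225]` (box of
`klU0w00`, containing `μ(0.20) ≈ -0.4267`; second-order margins of the box ≥ 0.0288), modulo the window files' named hypotheses.  Existence-grade;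
nothing here asserts a pairing instability. [cite: RaghuKivelsonScalapino2010, App. A] -/
theorem klThirdOrder_selection_box00 (hA : klCertB1gWinA.EnclosuresB1g) (hB : klCertB1gWinB.EnclosuresB1g)
    (hC : klCertB1gWinC.EnclosuresB1g)
    (h3 : KlThirdOrderWindowEnclosures klU0WindowRows [klCertB1gWinA, klCertB1gWinB, klCertB1gWinC]) :
    ∀ μ : ℝ, ((((-42749 : ℚ) / 100000) : ℚ) : ℝ) ≤ μ → μ ≤ ((((-169 : ℚ) / 400) : ℚ) : ℝ) →
      ∃ ψ : Momentum → ℝ, IsChannelState (squareDispersion 1 0) μ D4Irrep.B1g ψ ∧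
        ∀ U : ℝ, 0 < U → U ≤ 4267 / 16777216 → ∀ χ : D4Irrep, χ ≠ D4Irrep.B1g →
          ∀ φ : Momentum → ℝ, IsChannelState (squareDispersion 1 0) μ χ φ →
            thirdOrderForm (squareDispersion 1 0) μ U ψ < thirdOrderForm (squareDispersion 1 0) μ U φ := by
  intro μ hlo hhi
  obtain ⟨hmem, hmulo, hmuhi, hU0⟩ := klbw_w00_data
  obtain ⟨ψ, hψ, h⟩ := klThirdOrder_selection_boxwise hA hB hC h3 klU0w00 hmem μ (by rw [hmulo]; exact hlo)
    (by rw [hmuhi]; exact hhi)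
  refine ⟨ψ, hψ, fun U hU hUU => h U hU ?_⟩
  rw [hU0]
  push_cast
  linarith

/-- **All-orders `B1g` selection modulo `C4 = 10` at the `δ ≈ 0.20` end for `0 < U ≤ 4267/2²⁴`** (box of `klU0w00`), for every remainder kernel
with the `C4 = 10` form bounds on `(0, 1/16]`.  `C4` ASSUMED; existence-grade; nothing here asserts a pairing instability.
[cite: RaghuKivelsonScalapino2010, App. A] -/
theorem klAllOrders_selection_box00 (hA : klCertB1gWinA.EnclosuresB1g) (hB : klCertB1gWinB.EnclosuresB1g)
    (hC : klCertB1gWinC.EnclosuresB1g)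
    (h3 : KlResummedWindowEnclosures klU0WindowRows [klCertB1gWinA, klCertB1gWinB, klCertB1gWinC])
    (R : ℝ → Momentum → Momentum → ℝ)
    (hRB : ∀ c ∈ [klCertB1gWinA, klCertB1gWinB, klCertB1gWinC], ∀ bx ∈ c.boxes, ∀ μ : ℝ,
      ((bx.mulo : ℚ) : ℝ) ≤ μ → μ ≤ ((bx.muhi : ℚ) : ℝ) → ∀ U : ℝ, 0 < U → U ≤ 1 / 16 →
        kform (fermiCurveMeasure (squareDispersion 1 0) μ) (R U) (bx.bB1g.trialFun c.trials) ≤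
          10 * ∫ k, bx.bB1g.trialFun c.trials k ^ 2 ∂fermiCurveMeasure (squareDispersion 1 0) μ)
    (hRχ : ∀ μ : ℝ, ∀ U : ℝ, 0 < U → U ≤ 1 / 16 → ∀ χ : D4Irrep, χ ≠ D4Irrep.B1g →
      ∀ φ : Momentum → ℝ, IsChannelState (squareDispersion 1 0) μ χ φ →
        -10 ≤ kform (fermiCurveMeasure (squareDispersion 1 0) μ) (R U) φ) :
    ∀ μ : ℝ, ((((-42749 : ℚ) / 100000) : ℚ) : ℝ) ≤ μ → μ ≤ ((((-169 : ℚ) / 400) : ℚ) : ℝ) →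
      ∃ ψ : Momentum → ℝ, IsChannelState (squareDispersion 1 0) μ D4Irrep.B1g ψ ∧
        ∀ U : ℝ, 0 < U → U ≤ 4267 / 16777216 → ∀ χ : D4Irrep, χ ≠ D4Irrep.B1g →
          ∀ φ : Momentum → ℝ, IsChannelState (squareDispersion 1 0) μ χ φ →
            resummedForm (squareDispersion 1 0) μ U ψ + U ^ 2 * kform (fermiCurveMeasure (squareDispersion 1 0) μ) (R U) ψ <
              resummedForm (squareDispersion 1 0) μ U φ + U ^ 2 * kform (fermiCurveMeasure (squareDispersion 1 0) μ) (R U) φ := by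
  intro μ hlo hhi
  obtain ⟨hmem, hmulo, hmuhi, hU0⟩ := klbw_w00_data
  obtain ⟨ψ, hψ, h⟩ := klAllOrders_selection_boxwise hA hB hC h3 R hRB hRχ klU0w00 hmem μ (by rw [hmulo]; exact hlo)
    (by rw [hmuhi]; exact hhi)
  refine ⟨ψ, hψ, fun U hU hUU => h U hU ?_⟩
  rw [hU0]
  push_cast
  linarith

end Summit.HubbardSuperconductivity.HubbardSuperconductivity.Theorems

end
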